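import Mathlib.AlgebraicTopology.FundamentalGroupoid.SimplyConnected
import Literature.Geometry.Lorentzian.IPlusRegular
import Literature.Geometry.Lorentzian.Einstein
import Literature.Geometry.Lorentzian.Hypersurface
import HarnessLib

/-!
# Smooth spherical cross-sections of the event horizon of an `I⁺`-regular vacuum black hole
# (Chruściel–Costa 2008, Thm. 4.11 with Prop. 4.3 and Cor. 2.5)

One NAMED FACT (D-0014), `chruscielCosta2008_horizonSphericalSection`: the future event horizon
`𝓔⁺` of a four-dimensional vacuum `I⁺`-regular stationary asymptotically flat black hole with
connected (non-empty) horizon and simply connected domain of outer communications contains a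
compact cross-section which is a smoothly embedded spacelike `2`-sphere.

Printed ingredients (P. T. Chruściel, J. Lopes Costa, Astérisque 321 (2008) 195–265 =
arXiv:0806.0016):

* **Thm. 4.11** (§4.3, smoothness of event horizons): in a smooth asymptotically flat space-time
  with complete stationary Killing vector `K₍₀₎`, globally hyperbolic `⟨⟨M_ext⟩⟩`, vacuum at large
  distances and satisfying the null energy condition, if a component of the event horizon admits
  a compact cross-section `S ⊂ I⁺(M_ext)` which is the boundary of a spacelike hypersurface
  `𝒮 ⊃ Σ_ext` achronal in `⟨⟨M_ext⟩⟩` — all of this is part of `I⁺`-regularity, Def. 1.1 — then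
  `∪_t φ_t[K₍₀₎](S) = 𝓔⁺` is a smooth null hypersurface;
* **Prop. 4.3** (§4.1): when `𝓔⁺` is smooth and `⟨⟨M_ext⟩⟩` is globally hyperbolic, the compact
  cross-section moved to its future by the isometries (Prop. 4.1) can be chosen smooth (the proof
  makes it transverse to the null generators, i.e. spacelike);
* **Cor. 2.5** (§2.4): in space-time dimension four, for `I⁺`-regular stationary asymptotically
  flat space-times satisfying the null energy condition, cross-sections of `𝓔⁺` have spherical
  topology (topological censorship, Cor. 2.4 — the d.o.c. is simply connected —, together with
  Chruściel–Wald, Class. Quantum Grav. 11 (1994) L147, Thm. 2.3, and standard `3`-manifold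
  topology); a cross-section of a connected `𝓔⁺ ≈ ℝ × S` is connected (Prop. 4.1–4.2), hence ONE
  sphere.

Vacuum (`IsRicciFlat`) implies both the null energy condition and "vacuum at large distances";
simple connectedness of `⟨⟨M_ext⟩⟩` is ASSUMED here (as in the companion facts of
`EventHorizonSurfaceGravity.lean` and `DocProductStructure.lean`), so only the `3`-manifold step
of Cor. 2.5 is used.  A smooth `2`-manifold homeomorphic to `S²` is diffeomorphic to the standard
sphere, so "a smooth cross-section of spherical topology" is rendered as: an abstract `C^∞`
`2`-manifold `T` homeomorphic to the unit sphere of `ℝ³` and an injective spacelike immersion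
`ι : T → M` (`PseudoRiemannianMetric.IsSpacelikeImmersion`, which includes `C^∞`; an injective
immersion of a compact manifold is an embedding) whose image is a cross-section of `𝓔⁺`
(`IsCrossSectionOf`, `IPlusRegular.lean`).  This follows the rendering of "a surface homeomorphic
to the `2`-sphere" in `christodoulou_trapped_surface_formation` (`BlackHoles.lean`).

Requested by the line lead of crux stmt-FinalStateConjecture-17840
(`ZeroEnergyKerrOrBomb.HawkingExtensionIsKerr`, programme "NH"): with it, the analytic content of
`DegenerateVacuumHorizonNoCollar` (`EventHorizonSurfaceGravity.lean`) reduces to pointwise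
curvature identities and the tree's Gauss–Bonnet theorem (`Literature.Geometry.Riemannian.gaussBonnet`
with `χ(S²) = 2`).

-- TODO(general form): the cross-section is moreover transverse to the stationary Killing vector
-- and moved to its future by the isometry group (Prop. 4.1, Prop. 4.3); higher dimensions
-- (no sphericity); the null energy condition instead of vacuum; simple connectedness of the
-- d.o.c. derived (Cor. 2.4) rather than assumed.

## References

* P. T. Chruściel, J. Lopes Costa, *On uniqueness of stationary vacuum black holes*, Astérisque
  321 (2008) 195–265, arXiv:0806.0016: Def. 1.1, §2.4 (Cor. 2.4, Cor. 2.5), §4.1 (Prop. 4.1–4.3),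
  §4.3 (Thm. 4.11, Remark 4.15). [ChruscielCosta2008]
* P. T. Chruściel, R. M. Wald, *On the topology of stationary black holes*, Class. Quantum Grav.
  11 (1994) L147–L152, gr-qc/9410004, Thm. 2.3. [ChruscielWald1994Topology]
-/

noncomputable section

open Set
open scoped Manifold ContDiff Topology

namespace Literature.Geometry.Lorentzian

/-- **Smooth spherical cross-sections of the event horizon (Chruściel–Costa 2008, Thm. 4.11 with
Prop. 4.3 and Cor. 2.5; named fact, D-0014).**  For a four-dimensional vacuum, `I⁺`-regular
stationary asymptotically flat black hole `𝓑` with connected (hence non-empty) future event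
horizon `𝓔⁺ = 𝓑.horizon` and simply connected domain of outer communications `⟨⟨M_ext⟩⟩ = 𝓑.doc`:
there are a `C^∞` `2`-manifold `T` homeomorphic to the unit `2`-sphere and an injective spacelike
immersion `ι : T → M` (so a smooth embedding of a spacelike `2`-sphere) whose image lies in `𝓔⁺`
and is a cross-section of `𝓔⁺` (meets every null generator precisely once).  Printed: Thm. 4.11
(`𝓔⁺` is a smooth null hypersurface under `I⁺`-regularity and the null energy condition, both
implied here), Prop. 4.3 (the compact cross-section can then be chosen smooth, transverse to the
generators), Cor. 2.5 (cross-sections of `𝓔⁺` are spheres in dimension four; Chruściel–Wald 1994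
Thm. 2.3).  Weaker than print, see the module docstring.
[cite: ChruscielCosta2008, Thm. 4.11, Prop. 4.3, Cor. 2.5]
[cite: ChruscielWald1994Topology, Thm. 2.3] -/
def chruscielCosta2008_horizonSphericalSection : Prop :=
  ∀ (𝓑 : StationaryAFBlackHole.{0}) [𝓑.metric.HasLeviCivita],
    𝓑.metric.toPseudoRiemannianMetric.IsRicciFlat → 𝓑.IsIPlusRegular → IsConnected 𝓑.horizon →
    SimplyConnectedSpace 𝓑.doc →
    ∃ (T : Type) (_ : TopologicalSpace T) (_ : ChartedSpace (EuclideanSpace ℝ (Fin 2)) T)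
      (_ : IsManifold (𝓡 2) ∞ T) (_ : T ≃ₜ Metric.sphere (0 : E3) 1) (ι : T → 𝓑.carrier),
      𝓑.metric.toPseudoRiemannianMetric.IsSpacelikeImmersion (𝓡 2) ι ∧ Function.Injective ι ∧
      Set.range ι ⊆ 𝓑.horizon ∧ 𝓑.toSpacetime.IsCrossSectionOf 𝓑.horizon (Set.range ι)

/-- Hypothesis form of `chruscielCosta2008_horizonSphericalSection`: tautological unfolding.
Chruściel–Costa 2008, Thm. 4.11. [cite: ChruscielCosta2008, Thm. 4.11, Prop. 4.3, Cor. 2.5] -/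
theorem chruscielCosta2008_horizonSphericalSection.apply
    (h : chruscielCosta2008_horizonSphericalSection) (𝓑 : StationaryAFBlackHole.{0})
    [𝓑.metric.HasLeviCivita] (hvac : 𝓑.metric.toPseudoRiemannianMetric.IsRicciFlat)
    (hreg : 𝓑.IsIPlusRegular) (hconn : IsConnected 𝓑.horizon) (hsc : SimplyConnectedSpace 𝓑.doc) :
    ∃ (T : Type) (_ : TopologicalSpace T) (_ : ChartedSpace (EuclideanSpace ℝ (Fin 2)) T)
      (_ : IsManifold (𝓡 2) ∞ T) (_ : T ≃ₜ Metric.sphere (0 : E3) 1) (ι : T → 𝓑.carrier),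
      𝓑.metric.toPseudoRiemannianMetric.IsSpacelikeImmersion (𝓡 2) ι ∧ Function.Injective ι ∧
      Set.range ι ⊆ 𝓑.horizon ∧ 𝓑.toSpacetime.IsCrossSectionOf 𝓑.horizon (Set.range ι) :=
  h 𝓑 hvac hreg hconn hsc

end Literature.Geometry.Lorentzian

end
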